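import Literature.Probability.LatticeModels.CircleWeightBondModel
import Mathlib.MeasureTheory.Integral.Pi
import Mathlib.MeasureTheory.Integral.Prod
import Mathlib.Analysis.Calculus.ParametricIntegral
import HarnessLib

/-!
# The Nishimori gauge identity for a general single-bond weight

C. Garban, T. Spencer, *Continuous symmetry breaking along the Nishimori line*, J. Math. Phys.
**63** (2022) 093302 = arXiv:2109.01617, Lemma 2.1 (`h = 0`) with Remark 10: for the plane rotator
with an arbitrary continuous positive single-bond weight `W` (`BondSystem.pairWeight`,
`CircleWeightBondModel.lean`) and the matching Nishimori disorder (`pairDensity W`: i.i.d. phases of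
law `W(u)du/Z_W`), the bond variables `Y_a = u_a θ̄_{src a} θ_{tgt a}` are, under the averaged quenched
measure, i.i.d. with law `W(z)dz/Z_W`:

  `𝔼_W[⟨F(Y)⟩_{W,u}] = 𝔼_W[F(u)]`   for every continuous `F : U(1)^ι → ℂ`

(`BondSystem.pairAvg_pairCexpect_bondVar`). The proof is the printed one (gauge transformation
`θ ↦ θφ⁻¹`, `u ↦ u·Y(φ,1)`, average over `φ`, cancellation of `Z_u`, translation `u ↦ u·Y(θ,1)⁻¹`),
verbatim the tree's `NishimoriGaugeIdentity.lean` (cosine weight) with `e^{β Re z}` replaced by `W`.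
Also: the elementary calculus of `pairAvg` (linearity, monotonicity, Jensen) and the product formula
`𝔼_W[∏_a g_a(u_a)] = ∏_a ∫ g_a W/Z_W`. Theorems only.

## References

* C. Garban, T. Spencer, J. Math. Phys. 63 (2022) 093302, arXiv:2109.01617: Def. 1–2, Lemma 2.1
  with its proof (2.1)–(2.4), Remark 10. [GarbanSpencer2022]
-/

noncomputable section

open MeasureTheory Finset TopologicalSpace
open scoped BigOperators ComplexConjugate

namespace Literature.Probability.LatticeModels

variable [MeasurableSpace Circle] [BorelSpace Circle] {ι : Type*} [Fintype ι] {W : Circle → ℝ}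

/-! ### Elementary calculus of the disorder average `𝔼_W` -/

section Calculus

/-- `𝔼_W[1] = 1`. [folklore] -/
theorem pairAvg_const_one (hW : Continuous W) (hW0 : ∀ z, 0 < W z) :
    pairAvg (ι := ι) W (fun _ => (1 : ℝ)) = 1 := by
  simp only [pairAvg, smul_eq_mul, mul_one, integral_pairDensity hW hW0]

/-- Monotonicity of the disorder average for real continuous functionals. [folklore] -/
theorem pairAvg_mono (hW : Continuous W) (hW0 : ∀ z, 0 < W z) {Φ Ψ : (ι → Circle) → ℝ}
    (hΦ : Continuous Φ) (hΨ : Continuous Ψ) (h : ∀ u, Φ u ≤ Ψ u) : pairAvg W Φ ≤ pairAvg W Ψ := by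
  unfold pairAvg
  refine integral_mono (integrable_torusHaar_of_continuous ((continuous_pairDensity hW).smul hΦ))
    (integrable_torusHaar_of_continuous ((continuous_pairDensity hW).smul hΨ)) fun u => ?_
  exact smul_le_smul_of_nonneg_left (h u) (pairDensity_pos hW hW0 u).le

variable {E : Type*} [NormedAddCommGroup E] [NormedSpace ℝ E]

/-- The disorder average of a constant. [folklore] -/
theorem pairAvg_const [CompleteSpace E] (hW : Continuous W) (hW0 : ∀ z, 0 < W z) (c : E) :
    pairAvg (ι := ι) W (fun _ => c) = c := by
  unfold pairAvg
  rw [integral_smul_const, integral_pairDensity hW hW0, one_smul]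

/-- A pointwise bound `Φ ≤ c` gives `𝔼_W[Φ] ≤ c`. [folklore] -/
theorem pairAvg_le_const (hW : Continuous W) (hW0 : ∀ z, 0 < W z) {Φ : (ι → Circle) → ℝ}
    (hΦ : Continuous Φ) {c : ℝ} (h : ∀ u, Φ u ≤ c) : pairAvg W Φ ≤ c := by
  have := pairAvg_mono hW hW0 hΦ continuous_const h
  rwa [pairAvg_const hW hW0] at this

/-- Integrability of `D • Φ` for continuous `Φ`. [folklore] -/
theorem integrable_pairDensity_smul (hW : Continuous W) {Φ : (ι → Circle) → E} (hΦ : Continuous Φ) :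
    Integrable (fun u => pairDensity W u • Φ u) (torusHaar ι) :=
  integrable_torusHaar_of_continuous ((continuous_pairDensity hW).smul hΦ)

/-- Additivity of the disorder average (continuous functionals). [folklore] -/
theorem pairAvg_add (hW : Continuous W) {Φ Ψ : (ι → Circle) → E} (hΦ : Continuous Φ)
    (hΨ : Continuous Ψ) : pairAvg W (fun u => Φ u + Ψ u) = pairAvg W Φ + pairAvg W Ψ := by
  unfold pairAvg
  simp_rw [smul_add]
  exact integral_add (integrable_pairDensity_smul hW hΦ) (integrable_pairDensity_smul hW hΨ)

/-- The disorder average of a difference (continuous functionals). [folklore] -/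
theorem pairAvg_sub (hW : Continuous W) {Φ Ψ : (ι → Circle) → E} (hΦ : Continuous Φ)
    (hΨ : Continuous Ψ) : pairAvg W (fun u => Φ u - Ψ u) = pairAvg W Φ - pairAvg W Ψ := by
  unfold pairAvg
  simp_rw [smul_sub]
  exact integral_sub (integrable_pairDensity_smul hW hΦ) (integrable_pairDensity_smul hW hΨ)

/-- The disorder average of a finite sum (continuous functionals). [folklore] -/
theorem pairAvg_finset_sum (hW : Continuous W) {α : Type*} (s : Finset α)
    {Φ : α → (ι → Circle) → E} (hΦ : ∀ i ∈ s, Continuous (Φ i)) :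
    pairAvg W (fun u => ∑ i ∈ s, Φ i u) = ∑ i ∈ s, pairAvg W (Φ i) := by
  unfold pairAvg
  simp_rw [Finset.smul_sum]
  exact integral_finsetSum s fun i hi => integrable_pairDensity_smul hW (hΦ i hi)

/-- Constants factor out of the disorder average: `𝔼_W[c Φ] = c 𝔼_W[Φ]`. [folklore] -/
theorem pairAvg_const_mul (W : Circle → ℝ) (c : ℂ) (Φ : (ι → Circle) → ℂ) :
    pairAvg W (fun u => c * Φ u) = c * pairAvg W Φ := by
  unfold pairAvg
  rw [← integral_const_mul]
  refine integral_congr_ae (ae_of_all _ fun u => ?_)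
  simp only [Complex.real_smul]
  ring

/-- Real scalars factor out of the disorder average. [folklore] -/
theorem pairAvg_const_mul_real (W : Circle → ℝ) (c : ℝ) (Φ : (ι → Circle) → ℝ) :
    pairAvg W (fun u => c * Φ u) = c * pairAvg W Φ := by
  unfold pairAvg
  rw [← integral_const_mul]
  refine integral_congr_ae (ae_of_all _ fun u => ?_)
  simp only [smul_eq_mul]
  ring

/-- The real part of a disorder average is the average of the real part. [folklore] -/
theorem re_pairAvg (hW : Continuous W) {Φ : (ι → Circle) → ℂ} (hΦ : Continuous Φ) :
    (pairAvg W Φ).re = pairAvg W (fun u => (Φ u).re) := by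
  unfold pairAvg
  have h := integral_re (integrable_pairDensity_smul hW hΦ)
  simp only [RCLike.re_to_complex] at h
  rw [← h]
  refine integral_congr_ae (ae_of_all _ fun u => ?_)
  simp [Complex.real_smul]

/-- **Triangle inequality for the disorder average**: `‖𝔼_W[Φ]‖ ≤ 𝔼_W[‖Φ‖]` (positive weight).
[folklore] -/
theorem norm_pairAvg_le (hW : Continuous W) (hW0 : ∀ z, 0 < W z) (Φ : (ι → Circle) → E) :
    ‖pairAvg W Φ‖ ≤ pairAvg W (fun u => ‖Φ u‖) := by
  unfold pairAvg
  refine (norm_integral_le_integral_norm _).trans_eq ?_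
  refine integral_congr_ae (ae_of_all _ fun u => ?_)
  dsimp only
  rw [norm_smul, Real.norm_of_nonneg (pairDensity_pos hW hW0 u).le, smul_eq_mul]

/-- **Jensen for the disorder average**: `𝔼_W[g]² ≤ 𝔼_W[g²]` for a continuous real functional.
[folklore] -/
theorem pairAvg_sq_le (hW : Continuous W) (hW0 : ∀ z, 0 < W z) {g : (ι → Circle) → ℝ}
    (hg : Continuous g) : pairAvg W g ^ 2 ≤ pairAvg W (fun u => g u ^ 2) := by
  set m := pairAvg W g with hm
  have h0 : 0 ≤ pairAvg W (fun u => (g u - m) ^ 2) := by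
    unfold pairAvg
    exact integral_nonneg fun u => smul_nonneg (pairDensity_pos hW hW0 u).le (sq_nonneg _)
  have hexp : pairAvg W (fun u => (g u - m) ^ 2) =
      pairAvg W (fun u => g u ^ 2) - 2 * m * pairAvg W g + m ^ 2 := by
    have e : (fun u => (g u - m) ^ 2) = fun u => (g u ^ 2 - (2 * m) * g u) + m ^ 2 := by
      funext u; ring
    have h1 := pairAvg_add hW (Φ := fun u => g u ^ 2 - (2 * m) * g u) (Ψ := fun _ => m ^ 2)
      ((hg.pow 2).sub (continuous_const.mul hg)) continuous_const
    have h2 := pairAvg_sub hW (Φ := fun u => g u ^ 2) (Ψ := fun u => (2 * m) * g u)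
      (hg.pow 2) (continuous_const.mul hg)
    have h3 := pairAvg_const_mul_real (ι := ι) W (2 * m) g
    have h4 := pairAvg_const (ι := ι) hW hW0 (m ^ 2)
    rw [e, h1, h2, h3, h4]
  rw [hexp, ← hm] at h0
  nlinarith [h0]

/-- **Independence of the phases (product formula)**: `𝔼_W[∏_a g_a(u_a)] = ∏_a ∫ g_a W/Z_W`.
[cite: GarbanSpencer2022, Definition 1 (independence over the edges)] -/
theorem pairAvg_prod (W : Circle → ℝ) (g : ι → Circle → ℂ) :
    pairAvg W (fun u : ι → Circle => ∏ a, g a (u a)) =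
      ∏ a, ∫ z, (W z / circleWeightZ W : ℝ) * g a z ∂Measure.haarMeasure (⊤ : PositiveCompacts Circle) := by
  unfold pairAvg pairDensity torusHaar
  have : ∀ u : ι → Circle, (∏ a, W (u a) / circleWeightZ W : ℝ) • ∏ a, g a (u a) =
      ∏ a, (((W (u a) / circleWeightZ W : ℝ) : ℂ) * g a (u a)) := fun u => by
    rw [Complex.real_smul, Complex.ofReal_prod, ← Finset.prod_mul_distrib]
  simp_rw [this]
  exact integral_fintype_prod_eq_prod (𝕜 := ℂ) (fun (a : ι) (z : Circle) => ((W z / circleWeightZ W : ℝ) : ℂ) * g a z)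

end Calculus

namespace BondSystem

variable {V : Type*} [Fintype V] (G : BondSystem V ι)

/-! ### Continuity of quenched expectations in the disorder -/

/-- The partition function `Z_{W,u}` is continuous in the phases. [folklore] -/
theorem continuous_pairPartitionFn (hW : Continuous W) : Continuous (G.pairPartitionFn W) :=
  continuous_integral_torusHaar (G.continuous_pairWeight_uncurry hW)

/-- The quenched expectation `u ↦ ⟨F(u, ·)⟩_{W,u}` of a jointly continuous observable is continuous
in the phases (continuous positive weight). [folklore] -/
theorem continuous_pairCexpect (hW : Continuous W) (hW0 : ∀ z, 0 < W z)
    {F : (ι → Circle) → (V → Circle) → ℂ} (hF : Continuous (Function.uncurry F)) :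
    Continuous fun u => G.pairCexpect W u (F u) := by
  have h1 : Continuous fun u => ∫ θ, F u θ * (G.pairWeight W u θ : ℂ) ∂torusHaar V :=
    continuous_integral_torusHaar (g := fun u θ => F u θ * (G.pairWeight W u θ : ℂ))
      (hF.mul (Complex.continuous_ofReal.comp (G.continuous_pairWeight_uncurry hW)))
  have h2 : Continuous fun u => (G.pairPartitionFn W u : ℂ) :=
    Complex.continuous_ofReal.comp (G.continuous_pairPartitionFn hW)
  exact h1.div h2 fun u => by exact_mod_cast (G.pairPartitionFn_pos hW hW0 u).ne'

/-! ### Lemma 2.1 for the weight `W` -/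

omit [Fintype V] in
/-- The gauge-shifted disorder density is the Gibbs weight:
`∏_a W(u_a φ̄_{src a} φ_{tgt a})/Z_W = (∏_a W(Y_a(φ,u))) / Z_W^{|ι|}`.
[cite: GarbanSpencer2022, proof of Lemma 2.1, (2.3)] -/
theorem pairDensity_mul_bondVar_one (W : Circle → ℝ) (u : ι → Circle) (φ : V → Circle) :
    pairDensity W (u * G.bondVar 1 φ) = G.pairWeight W u φ / circleWeightZ W ^ Fintype.card ι := by
  unfold pairDensity pairWeight
  rw [Finset.prod_div_distrib, Finset.prod_const, Finset.card_univ]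
  congr 1
  refine Finset.prod_congr rfl fun a _ => ?_
  simp only [bondVar, Pi.mul_apply, Pi.one_apply, one_mul, mul_assoc]

/-- Averaging the gauge-shifted density over the gauge group gives the partition function:
`∫ ∏_a W(u_a φ̄_{src a} φ_{tgt a})/Z_W dφ = Z_{W,u} / Z_W^{|ι|}`.
[cite: GarbanSpencer2022, proof of Lemma 2.1, (2.3)–(2.4)] -/
theorem integral_pairDensity_mul_bondVar_one (W : Circle → ℝ) (u : ι → Circle) :
    ∫ φ, pairDensity W (u * G.bondVar 1 φ) ∂torusHaar V =
      G.pairPartitionFn W u / circleWeightZ W ^ Fintype.card ι := by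
  simp only [pairDensity_mul_bondVar_one, integral_div, pairPartitionFn]

/-- Gauge invariance of the quenched expectation of bond-variable observables:
`⟨F(Y)⟩_{u · Y(φ,1)} = ⟨F(Y)⟩_u`. [cite: GarbanSpencer2022, proof of Lemma 2.1, (2.2)] -/
theorem pairCexpect_bondVar_gauge (W : Circle → ℝ) (u : ι → Circle) (φ : V → Circle)
    (F : (ι → Circle) → ℂ) :
    G.pairCexpect W (u * G.bondVar 1 φ) (fun θ => F (G.bondVar (u * G.bondVar 1 φ) θ)) =
      G.pairCexpect W u (fun θ => F (G.bondVar u θ)) := by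
  rw [pairCexpect_mul_bondVar_one]
  simp only [bondVar_mul_bondVar_one, inv_mul_cancel_right]

/-- **Garban–Spencer 2022, Lemma 2.1 (`h = 0`) for a general single-bond weight (Remark 10).** For
every finite bond system, every continuous positive `W` and every continuous `F : U(1)^ι → ℂ`,
`𝔼_W[⟨F((u_a θ̄_{src a} θ_{tgt a})_a)⟩_{W,u}] = 𝔼_W[F(u)]`: under the averaged quenched measure the
bond variables are independent with the disorder's own law `W(z)dz/Z_W`.
[cite: GarbanSpencer2022, Lemma 2.1 and Remark 10] -/
theorem pairAvg_pairCexpect_bondVar (hW : Continuous W) (hW0 : ∀ z, 0 < W z)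
    {F : (ι → Circle) → ℂ} (hF : Continuous F) :
    pairAvg W (fun u => G.pairCexpect W u (fun θ => F (G.bondVar u θ))) = pairAvg W F := by
  -- notation
  set Ex : (ι → Circle) → ℂ := fun u => G.pairCexpect W u (fun θ => F (G.bondVar u θ)) with hEx
  have hFY : Continuous (Function.uncurry fun (u : ι → Circle) (θ : V → Circle) => F (G.bondVar u θ)) :=
    hF.comp (continuous_pi fun a => G.continuous_bondVar_uncurry a)
  have hExc : Continuous Ex := G.continuous_pairCexpect hW hW0 hFY
  have hD := continuous_pairDensity (ι := ι) hW
  have hZρ : (0 : ℝ) < circleWeightZ W ^ Fintype.card ι := pow_pos (circleWeightZ_pos hW hW0) _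
  have hZρC : ((circleWeightZ W ^ Fintype.card ι : ℝ) : ℂ) ≠ 0 := by exact_mod_cast hZρ.ne'
  have hZ1 : (circleWeightZ W : ℂ) ≠ 0 := by exact_mod_cast (circleWeightZ_pos hW hW0).ne'
  -- Step 1: for every gauge `φ`, move the density
  have step1 : ∀ φ : V → Circle, pairAvg W Ex =
      ∫ u, (pairDensity W (u * G.bondVar 1 φ) : ℂ) * Ex u ∂torusHaar ι := by
    intro φ
    unfold pairAvg
    rw [← integral_torusHaar_mul_right (fun u => pairDensity W u • Ex u) (G.bondVar 1 φ)]
    refine integral_congr_ae (ae_of_all _ fun u => ?_)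
    simp only [Complex.real_smul, hEx]
    rw [pairCexpect_bondVar_gauge]
  -- Step 2: average Step 1 over `φ` and swap the integrals
  have step2 : pairAvg W Ex =
      ∫ u, (∫ φ, (pairDensity W (u * G.bondVar 1 φ) : ℂ) ∂torusHaar V) * Ex u ∂torusHaar ι := by
    have hc : Continuous (Function.uncurry fun (φ : V → Circle) (u : ι → Circle) =>
        (pairDensity W (u * G.bondVar 1 φ) : ℂ) * Ex u) := by
      refine (Complex.continuous_ofReal.comp (hD.comp ?_)).mul (hExc.comp continuous_snd)
      exact continuous_snd.mul (continuous_pi fun a =>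
        (G.continuous_bondVar_uncurry a).comp (continuous_const.prodMk continuous_fst))
    calc pairAvg W Ex = ∫ _φ : V → Circle, pairAvg W Ex ∂torusHaar V := by
          simp only [integral_const, probReal_univ, one_smul]
      _ = ∫ φ, ∫ u, (pairDensity W (u * G.bondVar 1 φ) : ℂ) * Ex u ∂torusHaar ι ∂torusHaar V :=
          integral_congr_ae (ae_of_all _ fun φ => step1 φ)
      _ = ∫ u, ∫ φ, (pairDensity W (u * G.bondVar 1 φ) : ℂ) * Ex u ∂torusHaar V ∂torusHaar ι :=
          integral_integral_swap
            (integrable_of_continuous_of_isFiniteMeasure ((torusHaar V).prod (torusHaar ι)) hc)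
      _ = _ := by
          refine integral_congr_ae (ae_of_all _ fun u => ?_)
          exact integral_mul_const _ _
  -- Step 3: the `φ`-average of the shifted density is `Z_u / Z_W^{|ι|}`, which cancels `Z_u`
  have step3 : pairAvg W Ex = (∫ u, ∫ θ, F (G.bondVar u θ) * G.pairWeight W u θ ∂torusHaar V
      ∂torusHaar ι) / (circleWeightZ W ^ Fintype.card ι : ℝ) := by
    rw [step2, eq_div_iff hZρC, ← integral_mul_const]
    refine integral_congr_ae (ae_of_all _ fun u => ?_)
    dsimp only
    have hZuC : (G.pairPartitionFn W u : ℂ) ≠ 0 := by exact_mod_cast (G.pairPartitionFn_pos hW hW0 u).ne'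
    rw [integral_complex_ofReal, integral_pairDensity_mul_bondVar_one, hEx]
    dsimp only [pairCexpect]
    push_cast
    field_simp
  -- Step 4: swap, and freeze the bond variables by `u ↦ u · Y(θ,1)⁻¹`
  have step4 : ∫ u, ∫ θ, F (G.bondVar u θ) * G.pairWeight W u θ ∂torusHaar V ∂torusHaar ι =
      ∫ u, F u * (∏ a, W (u a) : ℝ) ∂torusHaar ι := by
    have hc : Continuous (Function.uncurry fun (u : ι → Circle) (θ : V → Circle) =>
        F (G.bondVar u θ) * (G.pairWeight W u θ : ℂ)) :=
      hFY.mul (Complex.continuous_ofReal.comp (G.continuous_pairWeight_uncurry hW))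
    refine (integral_integral_swap
      (integrable_of_continuous_of_isFiniteMeasure ((torusHaar ι).prod (torusHaar V)) hc)).trans ?_
    calc ∫ θ, ∫ u, F (G.bondVar u θ) * (G.pairWeight W u θ : ℂ) ∂torusHaar ι ∂torusHaar V
        = ∫ _θ : V → Circle, ∫ u, F u * (∏ a, W (u a) : ℝ) ∂torusHaar ι ∂torusHaar V := by
          refine integral_congr_ae (ae_of_all _ fun θ => ?_)
          dsimp only
          rw [← integral_torusHaar_mul_right _ (G.bondVar 1 θ)⁻¹]
          refine integral_congr_ae (ae_of_all _ fun u => ?_)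
          dsimp only
          simp only [pairWeight]
          rw [G.bondVar_mul_inv_bondVar_one u θ]
      _ = _ := by simp only [integral_const, probReal_univ, one_smul]
  -- conclusion
  rw [step3, step4]
  unfold pairAvg pairDensity
  rw [div_eq_iff hZρC, ← integral_mul_const]
  refine integral_congr_ae (ae_of_all _ fun u => ?_)
  dsimp only
  rw [Complex.real_smul, Finset.prod_div_distrib, Finset.prod_const, Finset.card_univ]
  push_cast
  field_simp

end BondSystem

end Literature.Probability.LatticeModels
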